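import Literature.Computability.Complexity.DegreeThreeEncoding
import Literature.Computability.Complexity.CodeFPStrings
import HarnessLib

/-!
# Randomizing polynomials VII: the degree-3 block is typed polynomial time

The block `ikBlock n₀ T ρ` of file III as a functional program on codes: every piece (`tri`, `pos`,
the symbolic entries `symR1`/`symL`/`symR2`, products `mulP`, `entry`, `pairsLE`, `ikBlock`) is
`CodeFP` between the binary / raw-list codes of the typed polynomial-time algebra (`CodeFP.lean`,
`CodeFPArith.lean`, `CodeFPBudgets.lean`), assembled from `map`/`filter`/`flatten` with contexts
and binary arithmetic — no machine, transducer or growth estimate is written.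

## References

* S. Arora, B. Barak, *Computational Complexity: A Modern Approach*, CUP 2009, §1.3 (closure of
  polynomial time under composition and polynomially bounded loops).
* Y. Ishai, E. Kushilevitz, ICALP 2002, §3 (the block).
-/

namespace Literature.Computability.Complexity

namespace RandPoly

open CodeFP (natE pairE rawE listE bitE unE)

/-! ### Arithmetic of the numbering -/

/-- `tri` is computed on codes (`j (j+1) / 2`). [cite: AroraBarak2009, §1.3] -/
theorem codeFP_tri : CodeFP natE natE tri :=
  (CodeFP.natDiv.comp ((CodeFP.natMul.comp ((CodeFP.id natE).pair
    (CodeFP.natAdd.comp ((CodeFP.id natE).pair (CodeFP.const natE 1))))).pair (CodeFP.const natE 2))).congr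
    fun j => (tri_eq j).symm

/-- `pos` is computed on codes. [cite: AroraBarak2009, §1.3] -/
theorem codeFP_pos : CodeFP (pairE natE natE) natE (fun p => pos p.1 p.2) :=
  (CodeFP.natAdd.comp ((codeFP_tri.comp (CodeFP.snd natE natE)).pair (CodeFP.fst natE natE))).congr
    fun _ => rfl

/-- `blockSize` is computed on codes. [cite: AroraBarak2009, §1.3] -/
theorem codeFP_blockSize : CodeFP (rawE natE) natE blockSize :=
  (codeFP_pos.comp (((CodeFP.natSub.comp ((CodeFP.natLength natE).pair (CodeFP.const (rawE natE) 1))).pair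
    (CodeFP.natSub.comp ((CodeFP.natLength natE).pair (CodeFP.const (rawE natE) 1)))))).congr fun _ => rfl

/-- `[[x]]`: the polynomial consisting of the single variable `x`. [folklore] -/
theorem codeFP_varPoly : CodeFP natE (rawE (rawE natE)) (fun x => [[x]]) :=
  (CodeFP.rawSingleton (rawE natE)).comp (CodeFP.rawSingleton natE)

/-! ### The symbolic entries -/

/-- `symR1 n₀ i j` on codes (argument `(n₀, i, j)`). [cite: AroraBarak2009, §1.3] -/
theorem codeFP_symR1 : CodeFP (pairE natE (pairE natE natE)) (rawE (rawE natE)) (fun c => symR1 c.1 c.2.1 c.2.2) := by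
  have hN : CodeFP (pairE natE (pairE natE natE)) natE (fun c => c.1) := CodeFP.fst _ _
  have hI : CodeFP (pairE natE (pairE natE natE)) natE (fun c => c.2.1) := (CodeFP.snd _ _).fst'
  have hJ : CodeFP (pairE natE (pairE natE natE)) natE (fun c => c.2.2) := (CodeFP.snd _ _).snd'
  have hval : CodeFP (pairE natE (pairE natE natE)) (rawE (rawE natE)) (fun c => [[c.1 + pos c.2.1 c.2.2]]) :=
    codeFP_varPoly.comp (CodeFP.natAdd.comp (hN.pair (codeFP_pos.comp (hI.pair hJ))))
  refine ((CodeFP.natEq.comp (hI.pair hJ)).ite (CodeFP.const _ [[]])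
    ((CodeFP.natLt.comp (hI.pair hJ)).ite hval (CodeFP.const _ []))).congr fun c => ?_
  simp only [symR1, decide_eq_true_eq]

/-- The affine part as a polynomial, on codes. [folklore] -/
theorem codeFP_rhoPoly : CodeFP (rawE natE) (rawE (rawE natE)) (fun ρ => ρ.map fun r => [r]) :=
  CodeFP.map₀ (CodeFP.rawSingleton natE)

/-- `symL T ρ d j l` on codes (argument `((T, ρ, d), j, l)`). [cite: AroraBarak2009, §1.3] -/
theorem codeFP_symL :
    CodeFP (pairE (pairE (rawE natE) (pairE (rawE natE) natE)) (pairE natE natE)) (rawE (rawE natE))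
      (fun c => symL c.1.1 c.1.2.1 c.1.2.2 c.2.1 c.2.2) := by
  let cE := pairE (pairE (rawE natE) (pairE (rawE natE) natE)) (pairE natE natE)
  have hT : CodeFP cE (rawE natE) (fun c => c.1.1) := (CodeFP.fst _ _).fst'
  have hρ : CodeFP cE (rawE natE) (fun c => c.1.2.1) := (CodeFP.fst _ _).snd'.fst'
  have hD : CodeFP cE natE (fun c => c.1.2.2) := (CodeFP.fst _ _).snd'.snd'
  have hJ : CodeFP cE natE (fun c => c.2.1) := (CodeFP.snd _ _).fst'
  have hL : CodeFP cE natE (fun c => c.2.2) := (CodeFP.snd _ _).snd'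
  have h1 : CodeFP cE (rawE (rawE natE)) (fun c => if c.2.1 = c.2.2 then [[c.1.1.getD c.2.1 0]] else []) :=
    ((CodeFP.natEq.comp (hJ.pair hL)).ite (codeFP_varPoly.comp ((CodeFP.rawGetD natE (d := 0) rfl).comp (hT.pair hJ)))
      (CodeFP.const _ [])).congr fun c => by simp only [decide_eq_true_eq]
  have h2 : CodeFP cE (rawE (rawE natE)) (fun c => if c.2.1 = c.2.2 + 1 then [[]] else []) :=
    ((CodeFP.natEq.comp (hJ.pair (CodeFP.natAdd.comp (hL.pair (CodeFP.const _ 1))))).ite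
      (CodeFP.const _ [[]]) (CodeFP.const _ [])).congr fun c => by simp only [decide_eq_true_eq]
  have h3 : CodeFP cE (rawE (rawE natE)) (fun c => if c.2.1 = 0 ∧ c.2.2 = c.1.2.2 then c.1.2.1.map (fun r => [r]) else []) :=
    (((CodeFP.natEq.comp (hJ.pair (CodeFP.const _ 0))).and (CodeFP.natEq.comp (hL.pair hD))).ite
      (codeFP_rhoPoly.comp hρ) (CodeFP.const _ [])).congr fun c => by
        simp only [Bool.and_eq_true, decide_eq_true_eq]
  exact ((CodeFP.rawAppend (rawE natE)).comp (((CodeFP.rawAppend (rawE natE)).comp (h1.pair h2)).pair h3)).congr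
    fun c => rfl

/-- `symR2 n₀ d l k` on codes (argument `((n₀, d), l, k)`). [cite: AroraBarak2009, §1.3] -/
theorem codeFP_symR2 :
    CodeFP (pairE (pairE natE natE) (pairE natE natE)) (rawE (rawE natE)) (fun c => symR2 c.1.1 c.1.2 c.2.1 c.2.2) := by
  let cE := pairE (pairE natE natE) (pairE natE natE)
  have hN : CodeFP cE natE (fun c => c.1.1) := (CodeFP.fst _ _).fst'
  have hD : CodeFP cE natE (fun c => c.1.2) := (CodeFP.fst _ _).snd'
  have hL : CodeFP cE natE (fun c => c.2.1) := (CodeFP.snd _ _).fst'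
  have hK : CodeFP cE natE (fun c => c.2.2) := (CodeFP.snd _ _).snd'
  have h1 : CodeFP cE (rawE (rawE natE)) (fun c => if c.2.1 = c.2.2 then [[]] else []) :=
    ((CodeFP.natEq.comp (hL.pair hK)).ite (CodeFP.const _ [[]]) (CodeFP.const _ [])).congr
      fun c => by simp only [decide_eq_true_eq]
  have h2 : CodeFP cE (rawE (rawE natE)) (fun c => if c.2.2 = c.1.2 ∧ c.2.1 < c.1.2 then [[c.1.1 + pos c.2.1 c.2.1]] else []) :=
    (((CodeFP.natEq.comp (hK.pair hD)).and (CodeFP.natLt.comp (hL.pair hD))).ite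
      (codeFP_varPoly.comp (CodeFP.natAdd.comp (hN.pair (codeFP_pos.comp (hL.pair hL))))) (CodeFP.const _ [])).congr
      fun c => by simp only [Bool.and_eq_true, decide_eq_true_eq]
  exact ((CodeFP.rawAppend (rawE natE)).comp (h1.pair h2)).congr fun c => rfl

/-! ### Products and entries -/

/-- `mulP` on codes. [cite: AroraBarak2009, §1.3] -/
theorem codeFP_mulP : CodeFP (pairE (rawE (rawE natE)) (rawE (rawE natE))) (rawE (rawE natE)) (fun c => mulP c.1 c.2) := by
  -- inner: `(μ, q) ↦ q.map (μ ++ ·)`; outer: flatten of the map over `p` with context `q`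
  have hinner : CodeFP (pairE (rawE natE) (rawE (rawE natE))) (rawE (rawE natE)) (fun c => c.2.map fun ν => c.1 ++ ν) :=
    CodeFP.map (σ := List ℕ) (α := List ℕ) ((CodeFP.rawAppend natE).comp ((CodeFP.fst _ _).pair (CodeFP.snd _ _)))
  have houter : CodeFP (pairE (rawE (rawE natE)) (rawE (rawE natE))) (rawE (rawE (rawE natE))) (fun c => c.1.map fun μ => c.2.map fun ν => μ ++ ν) :=
    (CodeFP.map (σ := List (List ℕ)) (α := List ℕ) (hinner.comp ((CodeFP.snd _ _).pair (CodeFP.fst _ _)))).comp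
      ((CodeFP.snd _ _).pair (CodeFP.fst _ _))
  exact ((CodeFP.flatten (rawE natE)).comp houter).congr fun c => by simp [mulP, List.flatMap_def]

/-- The range `[0, d]` of matrix indices, `d = |T| - 1` (so `range 1` for the unused `T = []`):
`d + 1` in binary, converted to unary under the budget `|T| + 1`. [folklore] -/
theorem codeFP_rangeDim : CodeFP (rawE natE) (rawE natE) (fun T => List.range (T.length - 1 + 1)) := by
  have hb : CodeFP (rawE natE) natE (fun T => T.length - 1 + 1) :=
    CodeFP.natAdd.comp ((CodeFP.natSub.comp ((CodeFP.natLength natE).pair (CodeFP.const _ 1))).pair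
      (CodeFP.const _ 1))
  have hu : CodeFP (rawE natE) unE (fun T => min (T.length - 1 + 1) (T.length + 1)) :=
    CodeFP.unOfNatMin.comp ((CodeFP.unSucc.comp (CodeFP.ulength natE)).pair hb)
  exact (CodeFP.urange.comp hu).congr fun T => by rw [min_eq_left (by omega)]

/-- The inner summand of an entry: `(ctx, (i, k), (j, l)) ↦ R₁[i,j] · L[j,l] · R₂[l,k]`. [cite: AroraBarak2009, §1.3] -/
theorem codeFP_summand :
    CodeFP (pairE (pairE natE (pairE (rawE natE) (rawE natE))) (pairE (pairE natE natE) (pairE natE natE))) (rawE (rawE natE))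
      (fun c => mulP (mulP (symR1 c.1.1 c.2.1.1 c.2.2.1)
        (symL c.1.2.1 c.1.2.2 (c.1.2.1.length - 1) c.2.2.1 c.2.2.2))
        (symR2 c.1.1 (c.1.2.1.length - 1) c.2.2.2 c.2.1.2)) := by
  let cE := pairE (pairE natE (pairE (rawE natE) (rawE natE))) (pairE (pairE natE natE) (pairE natE natE))
  have hN : CodeFP cE natE (fun c => c.1.1) := (CodeFP.fst _ _).fst'
  have hT : CodeFP cE (rawE natE) (fun c => c.1.2.1) := (CodeFP.fst _ _).snd'.fst'
  have hρ : CodeFP cE (rawE natE) (fun c => c.1.2.2) := (CodeFP.fst _ _).snd'.snd'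
  have hD : CodeFP cE natE (fun c => c.1.2.1.length - 1) :=
    CodeFP.natSub.comp (((CodeFP.natLength natE).comp hT).pair (CodeFP.const _ 1))
  have hI : CodeFP cE natE (fun c => c.2.1.1) := (CodeFP.snd _ _).fst'.fst'
  have hK : CodeFP cE natE (fun c => c.2.1.2) := (CodeFP.snd _ _).fst'.snd'
  have hJ : CodeFP cE natE (fun c => c.2.2.1) := (CodeFP.snd _ _).snd'.fst'
  have hL : CodeFP cE natE (fun c => c.2.2.2) := (CodeFP.snd _ _).snd'.snd'
  have hR1 := codeFP_symR1.comp (hN.pair (hI.pair hJ))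
  have hLm := codeFP_symL.comp ((hT.pair (hρ.pair hD)).pair (hJ.pair hL))
  have hR2 := codeFP_symR2.comp ((hN.pair hD).pair (hL.pair hK))
  exact (codeFP_mulP.comp ((codeFP_mulP.comp (hR1.pair hLm)).pair hR2)).congr fun c => rfl

/-- `entry n₀ T ρ d i k` on codes, `d = |T| - 1` (argument `(ctx, i, k)`). [cite: AroraBarak2009, §1.3] -/
theorem codeFP_entry :
    CodeFP (pairE (pairE natE (pairE (rawE natE) (rawE natE))) (pairE natE natE)) (rawE (rawE natE))
      (fun c => entry c.1.1 c.1.2.1 c.1.2.2 (c.1.2.1.length - 1) c.2.1 c.2.2) := by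
  let cE := pairE (pairE natE (pairE (rawE natE) (rawE natE))) (pairE natE natE)
  -- the inner flatMap over `l` with context `(ctx, (i,k), j)`
  let c2E := pairE cE natE
  have hsum2 : CodeFP (pairE c2E natE) (rawE (rawE natE))
      (fun c => mulP (mulP (symR1 c.1.1.1.1 c.1.1.2.1 c.1.2)
        (symL c.1.1.1.2.1 c.1.1.1.2.2 (c.1.1.1.2.1.length - 1) c.1.2 c.2))
        (symR2 c.1.1.1.1 (c.1.1.1.2.1.length - 1) c.2 c.1.1.2.2)) :=
    codeFP_summand.comp (((CodeFP.fst _ _).fst'.fst').pair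
      (((CodeFP.fst _ _).fst'.snd').pair (((CodeFP.fst _ _).snd').pair (CodeFP.snd _ _))))
  have hrange : CodeFP cE (rawE natE) (fun c => List.range (c.1.2.1.length - 1 + 1)) :=
    codeFP_rangeDim.comp (CodeFP.fst _ _).snd'.fst'
  have hinner : CodeFP c2E (rawE (rawE natE)) (fun c => (List.range (c.1.1.2.1.length - 1 + 1)).flatMap fun l =>
      mulP (mulP (symR1 c.1.1.1 c.1.2.1 c.2) (symL c.1.1.2.1 c.1.1.2.2 (c.1.1.2.1.length - 1) c.2 l))
        (symR2 c.1.1.1 (c.1.1.2.1.length - 1) l c.1.2.2)) :=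
    ((CodeFP.flatten (rawE natE)).comp ((CodeFP.map (σ := ((ℕ × List ℕ × List ℕ) × ℕ × ℕ) × ℕ) (α := ℕ) hsum2).comp
      ((CodeFP.id c2E).pair (hrange.comp (CodeFP.fst _ _))))).congr fun c => by
        rw [List.flatMap_def]; rfl
  exact ((CodeFP.flatten (rawE natE)).comp ((CodeFP.map (σ := (ℕ × List ℕ × List ℕ) × ℕ × ℕ) (α := ℕ) hinner).comp
    ((CodeFP.id cE).pair hrange))).congr fun c => by
      rw [entry, List.flatMap_def]; rfl

/-! ### The block -/

/-- `pairsLE (|T| - 1)` on codes. [cite: AroraBarak2009, §1.3] -/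
theorem codeFP_pairsLE : CodeFP (rawE natE) (rawE (pairE natE natE)) (fun T => pairsLE (T.length - 1)) := by
  -- row `i`: the pairs `(i, k)`, `i ≤ k ≤ d`, with context `(T, i)`
  have hle : CodeFP (pairE natE natE) bitE (fun q => decide (q.1 ≤ q.2)) := CodeFP.natLe
  have hrow : CodeFP (pairE (rawE natE) natE) (rawE (pairE natE natE))
      (fun c => ((List.range (c.1.length - 1 + 1)).filter fun k => decide (c.2 ≤ k)).map fun k => (c.2, k)) := by
    have hfilt : CodeFP (pairE (rawE natE) natE) (rawE natE)
        (fun c => (List.range (c.1.length - 1 + 1)).filter fun k => decide (c.2 ≤ k)) :=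
      (CodeFP.filter (σ := List ℕ × ℕ) (α := ℕ) (hle.comp ((CodeFP.fst _ _).snd'.pair (CodeFP.snd _ _)))).comp
        ((CodeFP.id _).pair (codeFP_rangeDim.comp (CodeFP.fst _ _)))
    exact (CodeFP.map (σ := List ℕ × ℕ) (α := ℕ) ((CodeFP.fst _ _).snd'.pair (CodeFP.snd _ _))).comp
      ((CodeFP.id _).pair hfilt)
  exact ((CodeFP.flatten (pairE natE natE)).comp ((CodeFP.map (σ := List ℕ) (α := ℕ) hrow).comp
    ((CodeFP.id (rawE natE)).pair codeFP_rangeDim))).congr fun T => by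
      rw [pairsLE, List.flatMap_def]; rfl

/-- **The degree-3 block `ikBlock n₀ T ρ` is computed on codes** (argument `(n₀, T, ρ)`).
[cite: AroraBarak2009, §1.3] -/
theorem codeFP_ikBlock : CodeFP (pairE natE (pairE (rawE natE) (rawE natE))) (rawE (rawE (rawE natE))) (fun c => ikBlock c.1 c.2.1 c.2.2) :=
  ((CodeFP.map (σ := ℕ × List ℕ × List ℕ) (α := ℕ × ℕ)
    (codeFP_entry.comp ((CodeFP.fst _ _).pair (((CodeFP.snd _ _).fst').pair (CodeFP.snd _ _).snd')))).comp
    ((CodeFP.id (pairE natE (pairE (rawE natE) (rawE natE)))).pair (codeFP_pairsLE.comp (CodeFP.snd _ _).fst'))).congr fun _ => rfl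

end RandPoly

end Literature.Computability.Complexity
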